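import Literature.NumberTheory.EllipticCurves.MazurRubin2010.SelmerRankComparison
import HarnessLib

/-!
# Route `SylvesterTwoHeegnerIndex` (rung K7t), hand item 19229 `HeegnerIndexUpperAtTwoHSY`: the
# ONE-PLACE dichotomy and PARITY RIGIDITY for two Selmer structures — abstract engine of the reading
# «`Sel₂(E_p) = Sel₂(E_p^{(−1)})` for `p ≡ 4 (mod 9)`»

Cell `bsd-cm`, seat `bsd-cm-k7t-c2` (prover-bsd-cm-k7t-c2-g11-0). PARTITION (D-0054): CornerF at `p = 2`
(B14/O12) × 𝒞_HSY (`E_p : x³ + y³ = p`, `p ≡ 4, 7 (mod 9)`) × `p = 2` — types-the-object-of (the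
`2`-torsion layer `Ш(E_p)[2]` of the object the UPPER half bounds); kernel helper
`--supports stmt-BirchSwinnertonDyer-19229`; closes no cell and no item; BSD is not claimed.
Everything in this file is PROVED over the tree's Klagsbrun–Mazur–Rubin §3 engine
(`Literature/NumberTheory/EllipticCurves/QuadraticSelmerStructure.lean`,
`…/MazurRubin2010/SelmerRankComparison.lean`): no definition, no named fact, no `sorry`.

## What is proved (abstract, any field `F`; MR10/KMR: `F = 𝔽₂`)

Two Selmer structures `𝒮, 𝒮'` of one global metabolic structure whose local conditions AGREE at every
place except possibly one place `v₀`, where `dim W_{v₀} = 1` (equivalently `dim L_{v₀} = 2`):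

* `W_eq_or_inf_eq_bot_of_finrank_eq_one` — two Lagrangian LINES of one plane are equal or transverse;
* `selmerGroup_eq_or_transverse_of_eq_off` — hence EITHER `W_{v₀} = W'_{v₀}` and the two Selmer groups
  are EQUAL (as submodules), OR `W_{v₀} ⊓ W'_{v₀} = ⊥` and `dim H¹_𝒮' + 2·dim loc_{v₀}(H¹_𝒮) = dim H¹_𝒮 + 1`
  (Mazur–Rubin 2010 Cor. 3.4 (i) with `t = 1`), so that the dimensions differ by EXACTLY one
  (`finrank_selmerGroup_eq_add_one_or_of_transverse`);
* `selmerGroup_eq_of_eq_off_of_even` — PARITY RIGIDITY: if `dim H¹_𝒮 + dim H¹_𝒮'` is even, the first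
  alternative holds: the local conditions at `v₀` coincide and `H¹_𝒮 = H¹_𝒮'`;
* `inf_eq_bot_of_eq_off_of_not_even` — if it is odd, the conditions at `v₀` are transverse and the
  dimensions differ by exactly one.

These are corollaries of MR10 §3 / KMR Thm 3.9 that are NOT printed as such (MR10 uses the transverse
case with `t = 1` to move the Selmer rank by one, §4); they are stated here because they are the whole
linear-algebra content of the 𝒞_HSY reading below.

## The 𝒞_HSY reading (PAPER + numerics; NOT a kernel statement — the arithmetic instantiation of the
## engine, i.e. the Kummer conditions of `E` and of a quadratic twist `E^F` as two Selmer structures of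
## one Poonen–Rains structure on `H¹(ℚ, E[2])`, is not in the tree, cf. the named fact
## `MazurRubin2010.cor34ii_rat`)

For `E_p : y² = x³ − 432p²` and its `(−1)`-twist `E_p^{(−1)} : y² = x³ + 432p²` (`E_p[2] = E_p^{(−1)}[2]`,
MR10 Rem. 2.4) the two Kummer conditions in `H¹(ℚ, E_p[2])` agree at every `v ∉ {2, 3}`
(`H¹(ℝ, E_p[2]) = 0`; `E_p(ℚ_p)[2] = 0`; MR10 Lemma 2.10 at good odd `v`), agree at `v = 2` for every
odd `p` (formal group of `Y² + Y = X³ − (27p²+1)/4` over `ℚ₂(i)`: the trace of a point of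
`T`-valuation `½` has `T`-valuation exactly `1`, so `N E_p(ℚ₂(i)) ⊄ 2E_p(ℚ₂)`; Kramer 1981 Prop. 7), and
at `v = 3`: for `p ≡ 4 (9)` `E_p(ℚ₃)[2] = 0` (`16p² ≡ 4 (9)` is not a cube), so `H¹(ℚ₃, E_p[2]) = 0` and
(S4a) `Sel₂(E_p) = Sel₂(E_p^{(−1)})`, `dim Ш(E_p)[2] = d₂(E_p^{(−1)}) − 1`; for `p ≡ 7 (9)`
`E_p(ℚ₃)[2] = ℤ/2` (type III*, `c₃ = 2`) and the conditions are transverse lines, so (S4b)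
`d₂(E_p^{(−1)}) = d₂(E_p) + 1 − 2·dim loc₃ Sel₂(E_p)`.  For `p ≡ 4 (9)` the parity-rigidity theorem of
this file gives (S4a) a second time from KMR Thm 3.9 + `2`-parity (both `d₂` odd: `w(E_p) =
w(E_p^{(−1)}) = −1`).  Numerics: kit j275689 (16 primes) and the pre-registered kit j275776
(`p ≤ 6000`; STATUS 2026-08-27T10:18:47Z).  (S4a) is the `Ш[2]`-layer of bsd-cm-two's OBSERVATION
O-two-g9-1 («`ord₂ #Ш_an(E_p) = ord₂ #Ш_an(E_p^{(−1)})`», memo two §54.3) and the algebraic face of its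
COROLLARY C″; it bounds nothing `2^∞`-adic and proves neither half of `BSD(E_p, 2)`.

## References
* B. Mazur, K. Rubin, Invent. Math. 181 (2010) 541–575, Def. 3.1, Lemma 3.2, Prop. 3.3, Cor. 3.4, §4.
* Z. Klagsbrun, B. Mazur, K. Rubin, Ann. of Math. 178 (2013) 287–320, Thm. 3.9.
* K. Kramer, Trans. AMS 264 (1981) 121–135, Prop. 7; B. Mazur, K. Rubin, Ann. of Math. 166 (2007), §5.
* J. H. Silverman, *The Arithmetic of Elliptic Curves*, GTM 106, IV §1–2 (formal group, `[2]`, `F(X,Y)`).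
-/

set_option autoImplicit false
-- the Summit-side namespace `Summit.BirchSwinnertonDyer.BirchSwinnertonDyer.…` (summit = problem) is mandated by D-0017
set_option linter.dupNamespace false

noncomputable section

open Module Literature.NumberTheory.EllipticCurves Literature.LinearAlgebra.QuadraticForm

namespace Summit.BirchSwinnertonDyer.BirchSwinnertonDyer.Theorems.SylvesterTwoTwistSelmer

universe u v w x

variable {F : Type u} [Field F] {ι : Type v} {H : Type w} [AddCommGroup H] [Module F H]
  {L : ι → Type x} [∀ v, AddCommGroup (L v)] [∀ v, Module F (L v)] [∀ v, FiniteDimensional F (L v)]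
  {loc : ∀ v, H →ₗ[F] L v} {Λ : ∀ v, Submodule F (L v)} {S₀ : Finset ι}
  {𝓆 : GlobalMetabolicStructure loc Λ S₀} (𝒮 𝒮' : QuadraticSelmerStructure 𝓆)

/-! ## §1 Two Lagrangian lines of one plane -/

/-- The local conditions of two Selmer structures of one metabolic structure have the same dimension
at every place (both are Lagrangian for `q_v`: `2·dim W_v = dim L_v = 2·dim W'_v`, KMR Lemma 3.7 (ii)).
[cite: KlagsbrunMazurRubin2013, Lemma 3.7] -/
theorem finrank_W_eq (v : ι) : finrank F ↥(𝒮.W v) = finrank F ↥(𝒮'.W v) := by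
  have h₁ := 𝓆.two_mul_finrank_of_mem_lagrangians (𝒮.mem_lagrangians v)
  have h₂ := 𝓆.two_mul_finrank_of_mem_lagrangians (𝒮'.mem_lagrangians v)
  omega

/-- ONE-DIMENSIONAL DICHOTOMY: if `dim W_v = 1` then the local conditions of `𝒮` and `𝒮'` at `v` (two
lines of the plane `L_v`) are either EQUAL or TRANSVERSE (`W_v ⊓ W'_v = ⊥`).  Linear algebra only;
corollary used implicitly in Mazur–Rubin 2010 §4. [cite: MazurRubin2010, Cor. 3.4] -/
theorem W_eq_or_inf_eq_bot_of_finrank_eq_one {v : ι} (h1 : finrank F ↥(𝒮.W v) = 1) :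
    𝒮.W v = 𝒮'.W v ∨ 𝒮.W v ⊓ 𝒮'.W v = ⊥ := by
  have h1' : finrank F ↥(𝒮'.W v) = 1 := by rw [← finrank_W_eq 𝒮 𝒮' v, h1]
  by_cases hbot : 𝒮.W v ⊓ 𝒮'.W v = ⊥
  · exact Or.inr hbot
  · left
    -- the intersection is a nonzero subspace of the line `W_v`, hence all of it
    have hle : finrank F ↥(𝒮.W v ⊓ 𝒮'.W v) ≤ 1 := h1 ▸ Submodule.finrank_mono inf_le_left
    have hne : finrank F ↥(𝒮.W v ⊓ 𝒮'.W v) ≠ 0 := fun h => hbot (Submodule.finrank_eq_zero.1 h)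
    have heq : 𝒮.W v ⊓ 𝒮'.W v = 𝒮.W v :=
      Submodule.eq_of_le_of_finrank_eq inf_le_left (by omega)
    have hle' : 𝒮.W v ≤ 𝒮'.W v := by rw [← heq]; exact inf_le_right
    exact Submodule.eq_of_le_of_finrank_eq hle' (by rw [h1, h1'])

/-! ## §2 Selmer structures that agree off one place -/

/-- **ONE-PLACE COMPARISON.** Let `𝒮` (`E`) and `𝒮'` (`E^F`) be two Selmer structures of one global
metabolic structure whose local conditions agree at every place `v ≠ v₀`, with `dim W_{v₀} = 1`,
`v₀ ∈ S ⊇ Σ_𝒮 ∪ Σ_𝒮'`, under the Poitou–Tate and finiteness inputs of KMR Thm 3.9.  Then EITHER the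
conditions at `v₀` coincide and `H¹_𝒮 = H¹_𝒮'` (MR10 Cor. 3.4 (ii)), OR they are transverse and
`dim H¹_𝒮' + 2·dim loc_{v₀}(H¹_𝒮) = dim H¹_𝒮 + 1` (MR10 Cor. 3.4 (i) with `T = {v₀}`, `t = 1`).
[cite: MazurRubin2010, Cor. 3.4] -/
theorem selmerGroup_eq_or_transverse_of_eq_off {S : Finset ι} {v₀ : ι} (hS : 𝒮.places ⊆ S)
    (hS' : 𝒮'.places ⊆ S) (hv₀ : v₀ ∈ S) (hoff : ∀ v, v ≠ v₀ → 𝒮.W v = 𝒮'.W v)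
    (h1 : finrank F ↥(𝒮.W v₀) = 1) (hfin : FiniteDimensional F (unramifiedOutside loc Λ S))
    (hPT : 𝓆.IsSelfDualAt S) :
    (𝒮.W v₀ = 𝒮'.W v₀ ∧ 𝒮.selmerGroup = 𝒮'.selmerGroup) ∨
      (𝒮.W v₀ ⊓ 𝒮'.W v₀ = ⊥ ∧
        finrank F ↥𝒮'.selmerGroup + 2 * finrank F ↥(𝒮.locImage {v₀}) =
          finrank F ↥𝒮.selmerGroup + 1) := by
  classical
  rcases W_eq_or_inf_eq_bot_of_finrank_eq_one 𝒮 𝒮' h1 with heq | hbot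
  · refine Or.inl ⟨heq, 𝒮.selmerGroup_eq_of_forall_eq 𝒮' fun v => ?_⟩
    by_cases hv : v = v₀
    · subst hv; exact heq
    · exact hoff v hv
  · refine Or.inr ⟨hbot, ?_⟩
    have hT : ({v₀} : Finset ι) ⊆ S := Finset.singleton_subset_iff.2 hv₀
    have hoff' : ∀ v, v ∉ ({v₀} : Finset ι) → 𝒮.W v = 𝒮'.W v := fun v hv =>
      hoff v fun h => hv (Finset.mem_singleton.2 h)
    have hon : ∀ v, v ∈ ({v₀} : Finset ι) → 𝒮.W v ⊓ 𝒮'.W v = ⊥ := fun v hv => by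
      rw [Finset.mem_singleton.1 hv]; exact hbot
    have hsum : (∑ v ∈ ({v₀} : Finset ι), finrank F ↥(𝒮.W v)) = 1 := by
      rw [Finset.sum_singleton, h1]
    have hle1 : (∑ v ∈ ({v₀} : Finset ι), finrank F ↥(𝒮.W v)) - finrank F ↥(𝒮.locImage {v₀}) ≤ 1 := by
      rw [hsum]; omega
    have key := 𝒮.finrank_selmerGroup_eq_of_transverse_of_le_one 𝒮' hS hS' hT hoff' hon hfin hPT hle1
    rw [hsum] at key
    exact key

/-- In the transverse alternative the image `loc_{v₀}(H¹_𝒮)` is `0` or the whole line, so the two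
Selmer dimensions differ by EXACTLY one: `dim H¹_𝒮' = dim H¹_𝒮 + 1` (when `loc_{v₀}(H¹_𝒮) = 0`) or
`dim H¹_𝒮' + 1 = dim H¹_𝒮` (when it is the line) — the rank-moving step of Mazur–Rubin 2010 §4.
[cite: MazurRubin2010, Cor. 3.4] -/
theorem finrank_selmerGroup_eq_add_one_or_of_transverse {S : Finset ι} {v₀ : ι} (hS : 𝒮.places ⊆ S)
    (hS' : 𝒮'.places ⊆ S) (hv₀ : v₀ ∈ S) (hoff : ∀ v, v ≠ v₀ → 𝒮.W v = 𝒮'.W v)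
    (h1 : finrank F ↥(𝒮.W v₀) = 1) (hfin : FiniteDimensional F (unramifiedOutside loc Λ S))
    (hPT : 𝓆.IsSelfDualAt S) (hbot : 𝒮.W v₀ ⊓ 𝒮'.W v₀ = ⊥) :
    (finrank F ↥(𝒮.locImage {v₀}) = 0 ∧
        finrank F ↥𝒮'.selmerGroup = finrank F ↥𝒮.selmerGroup + 1) ∨
      (finrank F ↥(𝒮.locImage {v₀}) = 1 ∧
        finrank F ↥𝒮'.selmerGroup + 1 = finrank F ↥𝒮.selmerGroup) := by
  rcases selmerGroup_eq_or_transverse_of_eq_off 𝒮 𝒮' hS hS' hv₀ hoff h1 hfin hPT with ⟨heq, _⟩ | ⟨_, hkey⟩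
  · -- equal lines are not transverse unless the line is `0`, contradicting `dim W_{v₀} = 1`
    exfalso
    rw [← heq, inf_idem] at hbot
    rw [hbot, finrank_bot] at h1
    exact zero_ne_one h1
  · have hle : finrank F ↥(𝒮.locImage {v₀}) ≤ 1 := by
      have h := 𝒮.finrank_locImage_le ({v₀} : Finset ι)
      rwa [Finset.sum_singleton, h1] at h
    rcases Nat.le_one_iff_eq_zero_or_eq_one.1 hle with h0 | h1'
    · exact Or.inl ⟨h0, by omega⟩
    · exact Or.inr ⟨h1', by omega⟩

/-! ## §3 Parity rigidity -/

/-- **PARITY RIGIDITY.** Under the hypotheses of `selmerGroup_eq_or_transverse_of_eq_off`, if the two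
Selmer dimensions have the SAME PARITY then the local conditions at `v₀` coincide and the two Selmer
groups are EQUAL as submodules of `H`.  (KMR Thm 3.9 gives `dim H¹_𝒮 − dim H¹_𝒮' ≡ dim W_{v₀}/(W_{v₀} ∩
W'_{v₀}) (mod 2)`; equal parity forces the intersection to be the whole line.)  This is the engine of
the reading «`p ≡ 4 (9)` ⟹ `Sel₂(E_p) = Sel₂(E_p^{(−1)})`» (both `d₂` odd).
[cite: KlagsbrunMazurRubin2013, Thm. 3.9] [cite: MazurRubin2010, Cor. 3.4] -/
theorem selmerGroup_eq_of_eq_off_of_even {S : Finset ι} {v₀ : ι} (hS : 𝒮.places ⊆ S)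
    (hS' : 𝒮'.places ⊆ S) (hv₀ : v₀ ∈ S) (hoff : ∀ v, v ≠ v₀ → 𝒮.W v = 𝒮'.W v)
    (h1 : finrank F ↥(𝒮.W v₀) = 1) (hfin : FiniteDimensional F (unramifiedOutside loc Λ S))
    (hPT : 𝓆.IsSelfDualAt S)
    (hpar : Even (finrank F ↥𝒮.selmerGroup + finrank F ↥𝒮'.selmerGroup)) :
    𝒮.W v₀ = 𝒮'.W v₀ ∧ 𝒮.selmerGroup = 𝒮'.selmerGroup := by
  rcases selmerGroup_eq_or_transverse_of_eq_off 𝒮 𝒮' hS hS' hv₀ hoff h1 hfin hPT with h | ⟨_, hkey⟩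
  · exact h
  · exfalso
    obtain ⟨k, hk⟩ := hpar
    omega

/-- … and if the two Selmer dimensions have OPPOSITE PARITY then the local conditions at `v₀` are
transverse and the dimensions differ by exactly one (`finrank_selmerGroup_eq_add_one_or_of_transverse`).
This is the engine of the reading «`p ≡ 7 (9)` ⟹ `d₂(E_p^{(−1)}) = d₂(E_p) ± 1`» (`w(E_p) = −1`,
`w(E_p^{(−1)}) = +1`). [cite: KlagsbrunMazurRubin2013, Thm. 3.9] [cite: MazurRubin2010, Cor. 3.4] -/
theorem inf_eq_bot_of_eq_off_of_not_even {S : Finset ι} {v₀ : ι} (hS : 𝒮.places ⊆ S)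
    (hS' : 𝒮'.places ⊆ S) (hv₀ : v₀ ∈ S) (hoff : ∀ v, v ≠ v₀ → 𝒮.W v = 𝒮'.W v)
    (h1 : finrank F ↥(𝒮.W v₀) = 1) (hfin : FiniteDimensional F (unramifiedOutside loc Λ S))
    (hPT : 𝓆.IsSelfDualAt S)
    (hpar : ¬ Even (finrank F ↥𝒮.selmerGroup + finrank F ↥𝒮'.selmerGroup)) :
    𝒮.W v₀ ⊓ 𝒮'.W v₀ = ⊥ ∧
      (finrank F ↥𝒮'.selmerGroup = finrank F ↥𝒮.selmerGroup + 1 ∨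
        finrank F ↥𝒮'.selmerGroup + 1 = finrank F ↥𝒮.selmerGroup) := by
  rcases selmerGroup_eq_or_transverse_of_eq_off 𝒮 𝒮' hS hS' hv₀ hoff h1 hfin hPT with
      ⟨_, hSel⟩ | ⟨hbot, _⟩
  · exfalso
    apply hpar
    rw [hSel]
    exact ⟨finrank F ↥𝒮'.selmerGroup, rfl⟩
  · refine ⟨hbot, ?_⟩
    rcases finrank_selmerGroup_eq_add_one_or_of_transverse 𝒮 𝒮' hS hS' hv₀ hoff h1 hfin hPT hbot with
        ⟨_, h⟩ | ⟨_, h⟩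
    · exact Or.inl h
    · exact Or.inr h

/-! ## §4 The same with NO exceptional place: equal conditions everywhere -/

omit [∀ v, FiniteDimensional F (L v)] in
/-- Degenerate case recorded for consumers: if the local conditions agree at EVERY place — the
𝒞_HSY situation for `p ≡ 4 (9)` once `W₂ = W₂'` is known from the formal group at `2`, all other
`H¹(ℚ_v, E_p[2])` carrying no difference — the Selmer groups are equal and so are their dimensions and
orders (MR10 Cor. 3.4 (ii), tree `selmerGroup_eq_of_forall_eq`). [cite: MazurRubin2010, Cor. 3.4 (ii)] -/
theorem finrank_selmerGroup_eq_of_forall_eq (h : ∀ v, 𝒮.W v = 𝒮'.W v) :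
    finrank F ↥𝒮.selmerGroup = finrank F ↥𝒮'.selmerGroup := by
  rw [𝒮.selmerGroup_eq_of_forall_eq 𝒮' h]

end Summit.BirchSwinnertonDyer.BirchSwinnertonDyer.Theorems.SylvesterTwoTwistSelmer

end
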